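import Mathlib
import Summits.KontsevichZagierPeriods.Zeta5Search.Elimination.SignedDescentCore
import HarnessLib

/-!
# Signed descent: CONJECTURE D-exact from three thin constant-term nodes (fam-elim E-L29)

HONEST FRAMING: systematic search; no irrationality claim unless certified.  This file is bookkeeping about
identities between INTEGERS (Brown–Zudilin's leading coefficient `Q(a)` of (17) and the dual constant term
`dualConstantTerm a` of `Families/DualConstantTerm`); the three constant-term nodes below are HYPOTHESES (plain
`def … : Prop`, asserted nowhere); nothing is claimed about `ζ(5)`; records unmoved.

Part 2 of 2 of fam-elim E-L29 (split at a section boundary for the 400-line filing limit; declarations byte-identical to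
the staged single file of gen 29, sha256 `33dce15d…`): §4 the signed descent and its corollaries, §5 the STAR(3,5) sanity
instance.  Part 1 = `Elimination/SignedDescentCore.lean` (§1 `regionDescent`, §2 `qSign`, §3 the nodes).  The overview
below describes both parts.

## What is proved

1. **`regionDescent`** — gen-1's terminal descent (`WedgeDictionaryTerminalDescent`, in the provider form of
   `Elimination.explicitPQ_of_provider`) made GENERIC in the propagated predicate `G : (Fin 8 → ℤ) → Prop`: if `G`
   passes up a STAR step (apex with a zero slot and two distinct non-zero slot values, from the two sons `a − s_p`,
   `a − s_q`), up a PENCIL step (interior apex, from the base `a − DS` and the sons `a − s_i`), and holds at terminal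
   points given all points of lower level, then `G` holds at every region point.
2. **The sign of the moves**: `Σ_i p_i(a) = a₁+3a₂+3a₃−2a₄+a₅+6a₆+a₇−5a₈` (`sumP_eq`) goes up by `1` under every slot
   move `a ↦ a − s_k`, `k ≠ 6`, by `7` under `a ↦ a − s₆`, and down by `1` under `a ↦ a − DS`; hence the sign
   `qSign a := (−1)^{Σp(a)}` (`Int.negOnePow`, so that no truncation at negative `Σp` interferes) flips under every
   move of the descent (`qSign_add_slotDown`, `qSign_sub_dsUp`).
3. **`dexact_of_thin`** — CONJECTURE D-exact (`Families.Cellular.LeadingCoeffIsDualConstantTerm`, cert-2 / P2 g6) on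
   gen-1's region follows from THREE THIN CONSTANT-TERM NODES (the two three-term ones in cert-2's unsigned
   vocabulary), all guarded
   by a predicate `W` closed (on the region) under the slot moves `a ↦ a − s_k` (`b_k ≥ 1`) and under `a ↦ a − DS`
   (interior points):
   `CTStarZero W` (the STAR relation `κ·CT(a) + χ_qΠ_q·CT(a−s_q) − χ_pΠ_p·CT(a−s_p) = 0` at apexes WITH A ZERO SLOT
   only — the shape of cert-2's unconditional `dualConstantTerm_star35'`), `CTPencilSlot W s₀` (ONE pencil relation
   `pencilBase·CT(a−DS) − pencilApex·CT(a) + χΠ·CT(a−s_{s₀}) = 0` per interior apex) and `CTTerminal W` (the signed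
   identity `Q = qSign·CT` at terminal points `(N; x·𝟙_U)`).  The Q-side relations are the tree theorems
   `Elimination.dictStar_holds : DictStar` and `Elimination.dictPencil_holds : DictPencil` (fam-elim E-L25/E-L26);
   the two sign changes between the `Q`-relation and the `CT`-relation are exactly the flips of item 2.
   Corollaries: `dexact_cone_of_thin` (guard = Brown–Zudilin's cone `bzDen a ≥ 0`, which on the region is closed
   under the moves: `dualCone_add_slotDown`, `dualCone_sub_dsUp`; `bzNum a ≥ 0` is automatic, `bzNum_nonneg`),
   `dexact_region_of_thin` (no guard), and — entirely in cert-2's vocabulary — **`dexact_cone_of_thin_abs`**: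
   D-exact on region ∩ cone ⟸ D-exact at the TERMINAL cone points (`CTTerminalAbs DualCone`) ∧ `CTStarZero DualCone`
   ∧ `CTPencilSlot DualCone s₀`; the sign is supplied by `sumP_nonneg_of_cone` (`Σp ≥ 0` on region ∩ cone) and
   `QOf_eq_qSign_mul_abs` ((17) read off via `BinomialSum.Qcoeff_eq`: `Q = (−1)^{Σp}·Σ qTerm`, `qTerm ≥ 0`).

Evidence for the three nodes (NOT used in any proof): exact check of all instances on the 11 830 region points of
level `≤ 5` (145 992 STAR triples, 6 272 PENCIL pairs, `|Q| = CT` at every point, including the 1 650 points where one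
gap exponent is `−1` and `dualConstantTerm` truncates it), `HOME/pub-zeta5-fam-elim/g29/sanity/`.

[pub-zeta5 fam-elim gen 29; memo `HOME/pub-zeta5-fam-elim/g29/SIGNED-DESCENT.md`]
-/

open Finset

namespace Summit.KontsevichZagierPeriods.Zeta5Search.Elimination

open Summit.KontsevichZagierPeriods.Zeta5Search.WedgeDictionary
open Summit.KontsevichZagierPeriods.Zeta5Search.Families.Cellular (dualConstantTerm bzNum bzDen)
open Literature.NumberTheory.Irrationality.BrownZudilin2022 (bOfA Converges QOf pOf qOf Qcoeff zchoose
  convergenceForms b24 b14 b57 b35 b36)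

/-! ## 4. The signed descent -/

/-- The STAR coefficient `κ(p,q) = (b_p − b_q)(N + 1 − b_p − b_q)` does not vanish at a region apex with `b_p ≠ b_q`. -/
theorem starKappa_ne_zero {a : Fin 8 → ℤ} {j p q : ℕ} (hr : RegionHyp a j) (hp : p ∈ Icc 1 7) (hq : q ∈ Icc 1 7)
    (hne : bOfA a p ≠ bOfA a q) : starKappa (bOfA a) p q ≠ 0 := by
  have hbp := hr.2.2.1 p hp
  have hbq := hr.2.2.1 q hq
  simp only [starKappa]
  refine mul_ne_zero (sub_ne_zero.2 hne) ?_
  omega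

/-- The PENCIL apex coefficient `(c_{s₀} + 1)(c₀ + 2 − c_{s₀})`, `c = b(a − DS)`, does not vanish at an interior apex. -/
theorem pencilApex_ne_zero {a : Fin 8 → ℤ} {j s₀ : ℕ} (hr : RegionHyp a j) (hs₀ : s₀ ∈ Icc 1 7)
    (hpos : 1 ≤ bOfA a s₀) : pencilApex (bOfA (a - dsUp)) s₀ ≠ 0 := by
  have hb := hr.2.2.1 s₀ hs₀
  have h7 : s₀ ≤ 7 := (mem_Icc.1 hs₀).2
  have h1 : 1 ≤ s₀ := (mem_Icc.1 hs₀).1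
  simp only [pencilApex]
  rw [bOfA_sub_dsUp a s₀ h7, if_neg (by omega), bOfA_sub_dsUp a 0 (by norm_num), if_pos rfl]
  refine mul_ne_zero ?_ ?_ <;> omega

/-- **THE SIGNED DESCENT (PROVED).**  For a guard `W` closed on the region under the slot moves (at slots `≥ 1`) and
under `a ↦ a − DS` (at interior points), the three
thin constant-term nodes give the SIGNED identity `Q(a) = qSign(a)·CT(a)` at every region point in `W`.  The Q-side
three-term relations are the tree theorems `dictStar_holds` and `dictPencil_holds`; the passage STAR: sons → apex and
PENCIL: base + son → apex divides by `κ ≠ 0`, resp. by the apex coefficient `≠ 0`. -/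
theorem signed_dexact_of_thin (W : (Fin 8 → ℤ) → Prop)
    (hWs : ∀ (a : Fin 8 → ℤ) (j k : ℕ), RegionHyp a j → k ∈ Icc 1 7 → 1 ≤ bOfA a k → W a → W (a + slotDown k))
    (hWd : ∀ (a : Fin 8 → ℤ) (j : ℕ), RegionHyp a j → (∀ m ∈ Icc 1 7, 1 ≤ bOfA a m) → W a → W (a - dsUp))
    {s₀ : ℕ} (hs₀ : s₀ ∈ Icc 1 7) (hS : CTStarZero W) (hP : CTPencilSlot W s₀) (hT : CTTerminal W) :
    ∀ (a : Fin 8 → ℤ) (j : ℕ), RegionHyp a j → W a → QOf a = qSign a * dualConstantTerm a := by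
  refine regionDescent (fun a => W a → QOf a = qSign a * dualConstantTerm a) ?_ ?_ ?_
  · -- STAR step
    intro a j p q hr hp hq hp1 hq1 hne hzero hGq hGp hW
    have hpq : p ≠ q := by
      rintro rfl
      exact hne rfl
    have hrq : RegionHyp (a + slotDown q) j := regionHyp_slotDown hr hq hq1
    have hrp : RegionHyp (a + slotDown p) j := regionHyp_slotDown hr hp hp1
    obtain ⟨hQ0, -, -⟩ := dictStar_holds a p q j j j hp hq hpq hr hrq hrp
    have hQ : (starKappa (bOfA a) p q : ℚ) * QOf a - fanCoeff (bOfA a) q * QOf (a + slotDown q) +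
        fanCoeff (bOfA a) p * QOf (a + slotDown p) = 0 := by
      linear_combination hQ0
    have hCT := hS a j p q hr hW hp hq hp1 hq1 hne hzero
    have h₁ : QOf (a + slotDown q) = qSign (a + slotDown q) * dualConstantTerm (a + slotDown q) :=
      hGq (hWs a j q hr hq hq1 hW)
    have h₂ : QOf (a + slotDown p) = qSign (a + slotDown p) * dualConstantTerm (a + slotDown p) :=
      hGp (hWs a j p hr hp hp1 hW)
    rw [qSign_add_slotDown a hq] at h₁
    rw [qSign_add_slotDown a hp] at h₂
    have hκ : (starKappa (bOfA a) p q : ℚ) ≠ 0 := by exact_mod_cast starKappa_ne_zero hr hp hq hne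
    have hCT' : (starKappa (bOfA a) p q : ℚ) * dualConstantTerm a +
        fanCoeff (bOfA a) q * dualConstantTerm (a + slotDown q) -
          fanCoeff (bOfA a) p * dualConstantTerm (a + slotDown p) = 0 := by exact_mod_cast hCT
    have h₁' : (QOf (a + slotDown q) : ℚ) = -(qSign a : ℚ) * dualConstantTerm (a + slotDown q) := by
      exact_mod_cast h₁
    have h₂' : (QOf (a + slotDown p) : ℚ) = -(qSign a : ℚ) * dualConstantTerm (a + slotDown p) := by
      exact_mod_cast h₂
    have key : (starKappa (bOfA a) p q : ℚ) * ((QOf a : ℚ) - qSign a * dualConstantTerm a) = 0 := by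
      linear_combination hQ + (fanCoeff (bOfA a) q : ℚ) * h₁' - (fanCoeff (bOfA a) p : ℚ) * h₂' -
        (qSign a : ℚ) * hCT'
    have h0 := (mul_eq_zero.1 key).resolve_left hκ
    exact_mod_cast (sub_eq_zero.1 h0)
  · -- PENCIL step at slot `s₀`
    intro a j hr hpos hGb hGs hW
    have hca : a - dsUp + dsUp = a := sub_add_cancel a dsUp
    have hrb : RegionHyp (a - dsUp) j := regionHyp_sub_dsUp hr hpos
    have hps := hpos s₀ hs₀
    have hrs : RegionHyp (a + slotDown s₀) j := regionHyp_slotDown hr hs₀ hps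
    have hdic := dictPencil_holds (a - dsUp) s₀ j j j hs₀ hrb (by rw [hca]; exact hr) (by rw [hca]; exact hrs)
    rw [hca] at hdic
    obtain ⟨hQ0, -, -⟩ := hdic
    have hQ : (pencilBase (bOfA (a - dsUp)) : ℚ) * QOf (a - dsUp) + pencilApex (bOfA (a - dsUp)) s₀ * QOf a +
        fanCoeff (bOfA a) s₀ * QOf (a + slotDown s₀) = 0 := by
      linear_combination hQ0
    have hCT := hP a j hr hW hpos
    have h₀ : QOf (a - dsUp) = qSign (a - dsUp) * dualConstantTerm (a - dsUp) := hGb (hWd a j hr hpos hW)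
    have h₂ : QOf (a + slotDown s₀) = qSign (a + slotDown s₀) * dualConstantTerm (a + slotDown s₀) :=
      hGs s₀ hs₀ (hWs a j s₀ hr hs₀ hps hW)
    rw [qSign_sub_dsUp] at h₀
    rw [qSign_add_slotDown a hs₀] at h₂
    have hβ : (pencilApex (bOfA (a - dsUp)) s₀ : ℚ) ≠ 0 := by exact_mod_cast pencilApex_ne_zero hr hs₀ hps
    have hCT' : (pencilBase (bOfA (a - dsUp)) : ℚ) * dualConstantTerm (a - dsUp) -
        pencilApex (bOfA (a - dsUp)) s₀ * dualConstantTerm a +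
          fanCoeff (bOfA a) s₀ * dualConstantTerm (a + slotDown s₀) = 0 := by exact_mod_cast hCT
    have h₀' : (QOf (a - dsUp) : ℚ) = -(qSign a : ℚ) * dualConstantTerm (a - dsUp) := by exact_mod_cast h₀
    have h₂' : (QOf (a + slotDown s₀) : ℚ) = -(qSign a : ℚ) * dualConstantTerm (a + slotDown s₀) := by
      exact_mod_cast h₂
    have key : (pencilApex (bOfA (a - dsUp)) s₀ : ℚ) * ((QOf a : ℚ) - qSign a * dualConstantTerm a) = 0 := by
      linear_combination hQ - (pencilBase (bOfA (a - dsUp)) : ℚ) * h₀' - (fanCoeff (bOfA a) s₀ : ℚ) * h₂' +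
        (qSign a : ℚ) * hCT'
    have h0 := (mul_eq_zero.1 key).resolve_left hβ
    exact_mod_cast (sub_eq_zero.1 h0)
  · -- terminal points
    intro a j hTa hr _ hW
    exact hT a j hr hW hTa

/-- `CT ≥ 0` (all coefficients of `dualSpanProd` are non-negative, cert-2 `DualCT.coeff_dualSpanProd_nonneg`). -/
theorem dualConstantTerm_nonneg (a : Fin 8 → ℤ) : 0 ≤ dualConstantTerm a := by
  unfold dualConstantTerm
  exact Families.Cellular.DualCT.coeff_dualSpanProd_nonneg _ _

/-- **D-exact from the thin nodes, guarded form (PROVED).** `|Q(a)| = CT(a)` at every region point of `W`. -/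
theorem dexact_of_thin (W : (Fin 8 → ℤ) → Prop)
    (hWs : ∀ (a : Fin 8 → ℤ) (j k : ℕ), RegionHyp a j → k ∈ Icc 1 7 → 1 ≤ bOfA a k → W a → W (a + slotDown k))
    (hWd : ∀ (a : Fin 8 → ℤ) (j : ℕ), RegionHyp a j → (∀ m ∈ Icc 1 7, 1 ≤ bOfA a m) → W a → W (a - dsUp))
    {s₀ : ℕ} (hs₀ : s₀ ∈ Icc 1 7) (hS : CTStarZero W) (hP : CTPencilSlot W s₀) (hT : CTTerminal W) :
    ∀ (a : Fin 8 → ℤ) (j : ℕ), RegionHyp a j → W a → |QOf a| = dualConstantTerm a := by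
  intro a j hr hW
  rw [signed_dexact_of_thin W hWs hWd hs₀ hS hP hT a j hr hW, abs_mul, abs_qSign, one_mul,
    abs_of_nonneg (dualConstantTerm_nonneg a)]

/-- **D-exact on gen-1's region ∩ Brown–Zudilin's cone from the three thin nodes on the cone (PROVED).**  This is
the propagation half of cert-2's CONJECTURE D-exact (`Families.Cellular.LeadingCoeffIsDualConstantTerm`) restricted to
the region: what remains are the cone-guarded nodes `CTStarZero DualCone` (cf. `dualConstantTerm_star35'`),
`CTPencilSlot DualCone s₀` for ONE slot, and the terminal values `CTTerminal DualCone`. -/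
theorem dexact_cone_of_thin {s₀ : ℕ} (hs₀ : s₀ ∈ Icc 1 7) (hS : CTStarZero DualCone)
    (hP : CTPencilSlot DualCone s₀) (hT : CTTerminal DualCone) :
    ∀ (a : Fin 8 → ℤ) (j : ℕ), RegionHyp a j → (∀ i, 0 ≤ bzDen a i) → |QOf a| = dualConstantTerm a :=
  dexact_of_thin DualCone (fun _ _ _ _ hk hpos h => dualCone_add_slotDown h hk hpos)
    (fun _ _ _ hpos h => dualCone_sub_dsUp h hpos) hs₀ hS hP hT

/-- **D-exact on the region ∩ cone, entirely in cert-2's vocabulary (PROVED).**  CONJECTURE D-exact at every region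
point of Brown–Zudilin's cone follows from: D-exact at the TERMINAL points of the cone (`CTTerminalAbs DualCone`),
the zero-slot STAR relations for `CT` on the cone (`CTStarZero DualCone`) and ONE pencil relation for `CT` per interior
cone point (`CTPencilSlot DualCone s₀`).  The sign is supplied by `sumP_nonneg_of_cone`. -/
theorem dexact_cone_of_thin_abs {s₀ : ℕ} (hs₀ : s₀ ∈ Icc 1 7) (hS : CTStarZero DualCone)
    (hP : CTPencilSlot DualCone s₀) (hT : CTTerminalAbs DualCone) :
    ∀ (a : Fin 8 → ℤ) (j : ℕ), RegionHyp a j → (∀ i, 0 ≤ bzDen a i) → |QOf a| = dualConstantTerm a :=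
  dexact_cone_of_thin hs₀ hS hP (ctTerminal_of_abs DualCone (fun _ _ hr hW => sumP_nonneg_of_cone hr hW) hT)

/-- **D-exact on the whole region from the three unguarded thin nodes (PROVED)** (`dualConstantTerm` truncates the
`−1` gap exponents at the excluded corners; the identity was checked there too, 1 650 points of level `≤ 5`). -/
theorem dexact_region_of_thin {s₀ : ℕ} (hs₀ : s₀ ∈ Icc 1 7) (hS : CTStarZero fun _ => True)
    (hP : CTPencilSlot (fun _ => True) s₀) (hT : CTTerminal fun _ => True) :
    ∀ (a : Fin 8 → ℤ) (j : ℕ), RegionHyp a j → |QOf a| = dualConstantTerm a :=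
  fun a j hr =>
    dexact_of_thin (fun _ => True) (fun _ _ _ _ _ _ _ => trivial) (fun _ _ _ _ _ => trivial) hs₀ hS hP hT a j hr trivial

/-! ## 5. Sanity: cert-2's unconditional STAR(3,5) theorem is an instance of the STAR node -/

/-- The `(p,q) = (3,5)` instances of `CTStarZero DualCone` are cert-2's theorem `dualConstantTerm_star35'`
(`1 ≤ bzNum a 3 = b₃` and `1 ≤ bzDen a 5 = b₅` are the two slot hypotheses). -/
example (a : Fin 8 → ℤ) (j : ℕ) (hr : RegionHyp a j) (hW : DualCone a) (h3 : 1 ≤ bOfA a 3) (h5 : 1 ≤ bOfA a 5) :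
    starKappa (bOfA a) 3 5 * dualConstantTerm a + fanCoeff (bOfA a) 5 * dualConstantTerm (a + slotDown 5) -
      fanCoeff (bOfA a) 3 * dualConstantTerm (a + slotDown 3) = 0 := by
  refine Families.Cellular.dualConstantTerm_star35' a (bzNum_nonneg hr.2.1) hW ?_ ?_
  · simpa [bzNum, bOfA] using h3
  · have := (bzDen_eq_bOfA a).2.2.2.2.2.1
    rw [this]
    exact h5

end Summit.KontsevichZagierPeriods.Zeta5Search.Elimination
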